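import Summits.HodgeConjecture.FermatCycles.ConditionQFourfoldSearch
import Summits.HodgeConjecture.FermatCycles.ConditionQFourfoldEightyFourTable
import HarnessLib

/-!
# Shioda's stable-generation condition `(Q⁴ₘ)` at `m = 84` — kernel certificate (part E of 6)

HONEST FRAMING: explicit algebraic cycles for specific Hodge classes on Fermat/Delsarte varieties;
residual open instances listed; no claim on general Hodge.

Topic path `Summits/HodgeConjecture/FermatCycles/` of cell `pub-hfermat` (new work, not literature: a computer determination of the cell —
`pub-hfermat-enum/P4-TABLE.md` §(Q⁴ₘ), two implementations — certified by the Lean kernel). Framework: `ConditionQFourfold.lean`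
(certificate Booleans, searches `checkQU`/`checkQN`) and `ConditionQFourfoldSearch.lean` (`conditionQ_four_of_normalized`).

THE STATEMENT. Shioda, Math. Ann. 245 (1979) §4 p. 183: `(Qⁿₘ)` — every element of `Mₘ(y)`, `3 ≤ y ≤ n/2 + 1`, is `ξ₁ − ξ₂` with
`ξ₁, ξ₂ ∈ M'ₘ = ⟨Mₘ(1), Mₘ(2), Mₘ(3)^sd⟩` (pairs, Hodge classes of the Fermat surface, semi-decomposable sextuples); by his Claim
(p. 183, Lemmas 2–3) `(Qⁿₘ)` may replace `(Pⁿₘ)` in Theorem III (`⇒` the Hodge conjecture for `Xⁿₘ`); p. 184: "we do not know any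
value of `m` which satisfies `(Qₘ)` but not `(Pₘ)`". Tree: `Literature.AlgebraicGeometry.Shioda1979.ConditionQ m n`, `MPrime`,
`forall_of_conditionQ` (the Claim's arithmetic spine), `ConditionP` (Math. Ann. form of `(P)`), `FermatCharacter.ShiodaConditionUpTo`
(Proc. Japan Acad. form, with the semi-decomposable alternative).

WHAT IS PROVED HERE (level `m = 84`, part E).
* part E of 6: the kernel searches `checkQN 84 T 12 3`, `checkQN 84 T 15 3` (198119 tuples);

NUMBERS (this seat's search `code/lit/q4/q4norm.py` = implementation 2; implementation 1 = ENUM `code/enum/q4table.py`,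
`data/shioda_Q4_m3-100.json`): case U visits 203105 sorted tuples and case N 667273; 18936 of them are Hodge sextuples; all but 98 carry a
`(P)`-witness (case N pair 13120, case N quasi 3362, case N semi 522, case U pair 1599, case U quasi 227, case U semi 8); the other 98 — `(1, 6, 13, 69, 81, 82)` (case U); `(1, 12, 13, 69, 76, 81)` (case U); `(1, 13, 28, 51, 77, 82)` (case U); `(1, 13, 28, 58, 75, 77)` (case U); `(1, 13, 30, 58, 69, 81)` (case U); `(1, 13, 38, 50, 69, 81)` (case U); `(1, 13, 45, 54, 57, 82)` (case U); `(1, 13, 45, 57, 58, 78)` (case U); `(1, 13, 45, 57, 62, 74)` (case U); `(1, 13, 45, 57, 64, 72)` (case U); `(1, 13, 49, 51, 56, 82)` (case U); `(1, 13, 49, 56, 58, 75)` (case U); `(1, 25, 37, 43, 67, 79)` (case U); `(1, 25, 38, 43, 67, 78)` (case U); `(1, 26, 29, 45, 69, 82)` (case U); `(1, 28, 29, 51, 66, 77)` (case U); `(1, 29, 30, 43, 71, 78)` (case U); `(1, 29, 30, 45, 69, 78)` (case U); `(1, 29, 42, 45, 66, 69)` (case U); `(1, 29, 45, 48, 60,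 69)` (case U); `(1, 29, 49, 51, 56, 66)` (case U); `(1, 30, 32, 43, 68, 78)` (case U); `(1, 30, 37, 43, 62, 79)` (case U); `(1, 30, 38, 43, 62, 78)` (case U); `(1, 32, 33, 43, 68, 75)` (case U); `(1, 33, 38, 43, 62, 75)` (case U); `(2, 4, 39, 50, 76, 81)` (case N); `(2, 15, 39, 57, 58, 81)` (case N); `(2, 15, 40, 57, 64, 74)` (case N); `(2, 15, 46, 57, 58, 74)` (case N); `(2, 15, 46, 57, 64, 68)` (case N); `(2, 22, 32, 39, 76, 81)` (case N); `(2, 22, 39, 50, 58, 81)` (case N); `(3, 8, 34, 45, 80, 82)` (case N); `(3, 8, 45, 52, 62, 82)` (case N); `(3, 8, 45, 52, 64, 80)` (case N); `(3, 15, 28, 51, 77, 78)` (case N); `(3, 15, 28, 54, 75, 77)` (case N); `(3, 15, 49, 51, 56, 78)` (case N); `(3, 15, 49, 54, 56, 75)` (case N); `(3, 26, 27, 45, 69, 82)` (case N); `(3, 26, 34, 45, 62, 82)` (case N); `(3, 26, 34, 45, 64, 80)` (case N); `(3, 26, 45, 52, 62, 64)` (case N); `(3, 27, 28, 51, 66,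 77)` (case N); `(3, 27, 49, 51, 56, 66)` (case N); `(3, 33, 34, 45, 62, 75)` (case N); `(4, 10, 33, 62, 68, 75)` (case N); `(4, 20, 32, 39, 76, 81)` (case N); `(4, 20, 32, 54, 66, 76)` (case N); `(4, 20, 39, 50, 58, 81)` (case N); `(4, 30, 32, 40, 68, 78)` (case N); `(4, 32, 33, 40, 68, 75)` (case N); `(4, 33, 38, 40, 62, 75)` (case N); `(6, 7, 33, 56, 69, 81)` (case N); `(6, 8, 40, 64, 66, 68)` (case N); `(6, 16, 44, 52, 54, 80)` (case N); `(6, 27, 28, 39, 75, 77)` (case N); `(6, 27, 39, 49, 56, 75)` (case N); `(6, 28, 33, 35, 69, 81)` (case N); `(7, 9, 30, 56, 69, 81)` (case N); `(7, 9, 45, 56, 57, 78)` (case N); `(7, 9, 45, 56, 66, 69)` (case N); `(7, 18, 33, 56, 57, 81)` (case N); `(7, 33, 45, 54, 56, 57)` (case N); `(8, 15, 40, 57, 58, 74)` (case N); `(8, 15, 40, 57, 64, 68)` (case N); `(8, 15, 46, 57, 58, 68)` (case N); `(8, 18, 30, 52, 64, 80)` (case N); `(9, 15, 46, 51, 57,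 74)` (case N); `(9, 16, 22, 51, 74, 80)` (case N); `(9, 16, 44, 51, 52, 80)` (case N); `(9, 16, 50, 51, 52, 74)` (case N); `(9, 22, 39, 50, 51, 81)` (case N); `(9, 22, 44, 46, 51, 80)` (case N); `(9, 22, 46, 50, 51, 74)` (case N); `(9, 28, 30, 35, 69, 81)` (case N); `(9, 28, 35, 45, 57, 78)` (case N); `(9, 28, 35, 45, 66, 69)` (case N); `(9, 44, 46, 50, 51, 52)` (case N); `(10, 20, 27, 44, 69, 82)` (case N); `(10, 26, 27, 38, 69, 82)` (case N); `(10, 26, 27, 44, 69, 76)` (case N); `(10, 27, 33, 38, 69, 75)` (case N); `(10, 32, 33, 34, 68, 75)` (case N); `(10, 33, 34, 38, 62, 75)` (case N); `(15, 18, 28, 39, 75, 77)` (case N); `(15, 18, 39, 49, 56, 75)` (case N); `(16, 18, 20, 44, 76, 78)` (case N); `(16, 20, 27, 38, 69, 82)` (case N); `(16, 20, 27, 44, 69, 76)` (case N); `(16, 26, 27, 38, 69, 76)` (case N); `(18, 28, 33, 35, 57, 81)` (case N); `(20, 22, 32, 39, 58, 81)` (case N); `(27, 28, 30, 39, 51,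 77)` (case N); `(27, 30, 39, 49, 51, 56)` (case N); `(28, 33, 35, 45, 54, 57)` (case N); `(32, 33, 34, 38, 40, 75)` (case N) — carry the table
certificate(s) written out in the statements below (generators checked by `genB`, the identity `s + ΣX = ΣY` by `decide`, all inside the kernel search).

PRINT STATUS (lit seat, 2026-08-20). `84 = 2²·3·7`: HC for every `Xⁿ₈₄` IS in print (Aoki 2000 Thm 0.1 (i), p. 185). The point of this level is Shioda's QUESTION (p. 184): `(Q⁴₈₄)` holds while `(P⁴₈₄)` fails (98 sextuples without a `(P)`-witness; cell table, two implementations; kernel here).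

References: [Shioda1979HodgeFermat] T. Shioda, Math. Ann. 245 (1979) 175–184, §3 p. 180 (`(Pⁿₘ)`), §4 pp. 183–184 (`M'ₘ`, `(Qⁿₘ)`, Claim,
the question); [Shioda1979PJA] T. Shioda, Proc. Japan Acad. 55A (1979) §1 (Definition (i)–(iii), `(Pⁿₘ)'`); [daSilva2021HodgeFermat]
G. da Silva Jr., Experimental Results 2 (2021) e22, Def. 2.4, Question 1; [Aoki2000FermatTypeRemarks] N. Aoki, Comment. Math. Univ.
St. Pauli 49 (2000), Thm 0.1. Cell: `pub-hfermat-enum/P4-TABLE.md`, `data/shioda_Q4_m3-100.json`, `code/lit/q4/` (this seat).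
-/

namespace Summit.HodgeConjecture.FermatCycles.ConditionQFourfold

open Multiset
open Literature.AlgebraicGeometry.HodgeTheory Literature.AlgebraicGeometry.HodgeTheory.FermatCharacter
open Literature.AlgebraicGeometry.Shioda1982 Literature.AlgebraicGeometry.Shioda1979
open Summit.HodgeConjecture.FermatCycles.ShiodaConditionFourfold

/-! ### Level `84` — part E -/

/-! The certificate table at level `84` is the definition `table84` of `ConditionQFourfoldEightyFourTable.lean` (98 entries `(key, X, Y)`,
`s + ΣX = ΣY`; found by `code/lit/q4/q4norm.py`, every entry checked by the kernel inside the searches). -/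

set_option maxHeartbeats 0 in
/-- The `(Q)`-search at level `84`, case N, first free representative in `[12, 15)` (107890 tuples). Kernel.
[cite: Shioda1979HodgeFermat, §4 condition (Qⁿₘ), p. 183] -/
theorem checkQN_84_12 :
    checkQN 84
      table84
      12 3 = true := by
  decide +kernel

set_option maxHeartbeats 0 in
/-- The `(Q)`-search at level `84`, case N, first free representative in `[15, 18)` (90229 tuples). Kernel.
[cite: Shioda1979HodgeFermat, §4 condition (Qⁿₘ), p. 183] -/
theorem checkQN_84_15 :
    checkQN 84
      table84
      15 3 = true := by
  decide +kernel

end Summit.HodgeConjecture.FermatCycles.ConditionQFourfold
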